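import Summits.BirchSwinnertonDyer.Rank1Residual.ManinAdditive.SigmaTwoEtaEngines
import Summits.BirchSwinnertonDyer.Rank1Residual.ManinAdditive.SigmaThetaFamily
import Summits.BirchSwinnertonDyer.Rank1Residual.ManinAdditive.ShimuraKronecker
import HarnessLib
import HarnessLib.Audit.Tags


/-!
# E-an-154 `SigmaTwoIsEtaKummerAtFour` reduced to the classification of Shimura 2-characters (an g35, T-an-38)

TYPER NOTE (typer g19, TURNKEY T-an-38, part 2/2 of file E).  SOURCE = HOME/an/g35/SigmaTwoEta-an-g35-v2.lean sha16 a27f55a72dcf1306, lines 214–571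
VERBATIM except this note, eight one-line docstrings, the explicit-`χ` Kummer bridge `kummerClassEqShimura_of_jacobi` (an's lines 242–290) moved to
part 1 `SigmaTwoEtaEngines.lean`, and the imports: `SigmaTwoEtaEngines` (part 1 = an's lines 23–213), `SigmaThetaFamily`
(an's `SigmaThetaParity` was split; `thetaBody`, `newmanCond_theta_eight`, `hasEvenCuspOrders_theta_eight/_four_iff`, `sum_theta_weight` live
there) and `ShimuraKronecker` (E-an-158's proof `shimuraTwoCharIsKronecker`).  `@[conjecture] ShimuraTwoCharIsKronecker` (E-an-158) is typed AND
closed in this file (`shimuraTwoCharIsKronecker_holds`); `sigmaTwoIsEtaKummerAtFour_holds` closes E-an-154, the last open node of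
`SigmaEtaKummer.lean`; `exists_even_etaRealisation_of_isShimuraTwoChar` = E-an-154♯ (the C2 LEAD's blind-branch consumer).  ref1 §R145: E-an-158
SURVIVES.  BC5 (an): check158.py 500/500 levels `4 ∣ N ≤ 2000`.  PARTITION 0 · beyond-print theorem: YES per an (E-an-154 ∧ E-an-155: `Σ(N)[2]`
= the η-square Kummer classes at every `4 ∣ N`; print excludes `4 ∣ N`) · BSD / C2 / Manin `c = 1` NOT proved by this.

Imports `SigmaThetaParity` (T-an-37 v2 Part A: `thetaBody`, `newmanCond_theta_eight`, `hasEvenCuspOrders_theta_eight`,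
`hasEvenCuspOrders_theta_four_iff`).  Contents (no proof gaps; the only open `Prop` is `@[conjecture] ShimuraTwoCharIsKronecker`,
E-an-158, used as a hypothesis):
* ENGINES over `SigmaEtaKummer`: LEVEL RAISING `M ∣ N` for exponent vectors supported on `M.divisors`
  (`cuspOrder24 N r c = (N/M)·cuspOrder24 M r (gcd(c,M))`, `hasEvenCuspOrders_of_dvd`, `newmanCond_of_dvd`; integrality of
  the ramification index = `gcd(c², ML) ∣ L·gcd(c², M)`), ADDITIVITY (`hasEvenCuspOrders_add`, `newmanCond_two_mul_add`),
  JACOBI MULTIPLICATIVITY of the Kummer generator (`jacobiSym_prod_pow_natAbs_add`);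
* the explicit-`χ` KUMMER BRIDGE `kummerClassEqShimura_of_jacobi`;
* REALISATIONS `RealisesJ N r q`: `Θ_m` on `X₀(8m)` / `X₀(4m)` (`m ≡ 1 (4)`) realise `(m | ·)` (`jacobiSym_thetaGenerator`:
  the Kummer generator of `Θ_m` is `2^18 m^9`), `Θ₂` on `X₀(32)` realises `(2 | ·)` (kernel-decided), products and level raising;
  `exists_realisesJ`: every squarefree `q ∣ N` (odd unless `32 ∣ N`, `≡ 1 (4)` unless `8 ∣ N`) is realised at level `N`;
* `sigmaTwoIsEtaKummerAtFour_of_isKronecker : ShimuraTwoCharIsKronecker → SigmaTwoIsEtaKummerAtFour`.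
So the modular-forms half of the unit-class level law `Σ(N)[2] = V_sq` (all `4 ∣ N`) is closed in the kernel; what remains
(E-an-158) is character theory: even real characters through the Shimura radical are Kronecker symbols.
-/

namespace Summit.BirchSwinnertonDyer.Rank1Residual.ManinAdditive.SigmaEta

open Literature.NumberTheory.ModularForms
open Literature.NumberTheory.EllipticCurves.ModularForms
open scoped NumberTheorySymbols

/-! ## E-an-154 `SigmaTwoIsEtaKummerAtFour` reduced to the classification of Shimura 2-characters (an g35)

CONSTRUCTION (all proved below): a squarefree `q ∣ N` that is odd unless `32 ∣ N` and `≡ 1 (mod 4)` unless `8 ∣ N` is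
REALISED at level `N` — there is an exponent vector `r` with Newman's conditions and even cusp orders for `2r` and Kummer
generator `(∏ t^{|r_t|} | d) = (q | d)` — by level-raised theta functions: `Θ_q` on `X₀(8q)` (`8 ∣ N`, `q` odd), `Θ_q` on
`X₀(4q)` (`4 ∥ N`, `q ≡ 1 (4)`), times `Θ₂` on `X₀(32)` when `q` is even (`32 ∣ N`).  Composed with the explicit-`χ` Kummer
bridge this gives `SigmaTwoIsEtaKummerAtFour` from the purely character-theoretic statement `ShimuraTwoCharIsKronecker`
(every Shimura 2-character is such a Kronecker symbol) — the last stub, classical (real characters = Kronecker symbols). -/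

section SigmaTwoEta

/-- `r` REALISES the Kronecker symbol `(q | ·)` at level `N`: Newman's conditions and even cusp orders for `2r`, and the
Kummer generator `s' = ∏ t^{|r_t|}` satisfies `(s' | d) = (q | d)` for odd `d` coprime to `N`. -/
def RealisesJ (N : ℕ) (r : ℕ → ℤ) (q : ℕ) : Prop :=
  NewmanCond N (fun t => 2 * r t) 0 ∧ HasEvenCuspOrders N (fun t => 2 * r t) ∧
    ∀ d : ℕ, Odd d → Nat.Coprime d N → J(((∏ t ∈ N.divisors, t ^ (r t).natAbs : ℕ) : ℤ) | d) = J(q | d)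

/-- **Classification of Shimura 2-characters** (the remaining, purely character-theoretic stub of E-an-154; classical:
even real characters through the Shimura radical are Kronecker symbols): for `4 ∣ N ≠ 0` and `χ ∈ Σ(N)[2]` there is a
squarefree `q ∣ N`, odd unless `32 ∣ N`, `≡ 1 (mod 4)` unless `8 ∣ N`, with `χ(d) = (q | |d|)` for odd `d` coprime to `N`.
E-an-158; finite check: for all 500 levels `4 ∣ N ≤ 2000`, `#Σ(N)[2] = #{admissible q}` and the `κ_q` are pairwise distinct
members of `Σ(N)[2]` (an g35 `check158.py`). -/
@[conjecture]
def ShimuraTwoCharIsKronecker : Prop :=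
  ∀ N : ℕ, 4 ∣ N → N ≠ 0 → ∀ χ : DirichletCharacter ℤ N, IsShimuraTwoChar N χ →
    ∃ q : ℕ, Squarefree q ∧ q ∣ N ∧ (¬ 32 ∣ N → Odd q) ∧ (¬ 8 ∣ N → q % 4 = 1) ∧
      ∀ d : ℤ, Odd d → IsCoprime d N → χ (d : ZMod N) = J(q | d.natAbs)

/-! ### Algebra of realisations -/

/-- The zero exponent vector realises the trivial symbol `(1 | ·)`. -/
theorem realisesJ_zero (N : ℕ) : RealisesJ N (fun _ => 0) 1 := by
  refine ⟨⟨by simp, by simp, by simp, ?_⟩, fun c _ => ?_, fun d _ _ => by simp [jacobiSym.one_left]⟩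
  · exact ⟨1, by simp⟩
  · unfold cuspOrder24; simp

/-- Realisations multiply: exponent vectors add, `q`'s multiply. -/
theorem realisesJ_mul {N : ℕ} {r₁ r₂ : ℕ → ℤ} {q₁ q₂ : ℕ} (h₁ : RealisesJ N r₁ q₁) (h₂ : RealisesJ N r₂ q₂) :
    RealisesJ N (fun t => r₁ t + r₂ t) (q₁ * q₂) := by
  obtain ⟨hn₁, he₁, hj₁⟩ := h₁
  obtain ⟨hn₂, he₂, hj₂⟩ := h₂
  refine ⟨newmanCond_two_mul_add hn₁ hn₂, ?_, fun d hd hdN => ?_⟩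
  · have e : (fun t => 2 * (r₁ t + r₂ t)) = fun t => 2 * r₁ t + 2 * r₂ t := funext fun t => by ring
    rw [e]; exact hasEvenCuspOrders_add he₁ he₂
  · have hcop : ∀ t ∈ N.divisors, Int.gcd (t : ℤ) d = 1 := fun t ht => by
      rw [Int.gcd_natCast_natCast]
      exact Nat.Coprime.coprime_dvd_left (Nat.dvd_of_mem_divisors ht) hdN.symm
    rw [jacobiSym_prod_pow_natAbs_add hcop, hj₁ d hd hdN, hj₂ d hd hdN, Nat.cast_mul, jacobiSym.mul_left]

/-- Level raising of a realisation along `M ∣ N`. -/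
theorem realisesJ_of_dvd {M N : ℕ} (hMN : M ∣ N) (hN : N ≠ 0) {r : ℕ → ℤ} (hr : ∀ t ∉ M.divisors, r t = 0) {q : ℕ}
    (h : RealisesJ M r q) : RealisesJ N r q := by
  obtain ⟨hn, he, hj⟩ := h
  have hr2 : ∀ t ∉ M.divisors, (fun t => 2 * r t) t = 0 := fun t ht => by simp [hr t ht]
  refine ⟨newmanCond_of_dvd hMN hN _ hr2 hn, hasEvenCuspOrders_of_dvd hMN hN _ hr2 he, fun d hd hdN => ?_⟩
  rw [← Finset.prod_subset (Nat.divisors_subset_of_dvd hN hMN) (fun t _ ht => by rw [hr t ht]; simp)]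
  exact hj d hd (Nat.Coprime.coprime_dvd_right hMN hdN)

/-! ### The Kummer generator of a theta vector is `(m | ·)` -/

/-- `x^{|a+b|} = x^{|a|} · x^{|b|}` for `x = ±1`. -/
theorem unit_pow_natAbs_add {x : ℤ} (hx : x = 1 ∨ x = -1) (a b : ℤ) :
    x ^ (a + b).natAbs = x ^ a.natAbs * x ^ b.natAbs := by
  rcases hx with rfl | rfl
  · simp
  · exact neg_one_pow_natAbs_add a b

/-- Pushing a power through an `if t = a` exponent. -/
theorem pow_natAbs_ite (F : ℕ → ℤ) (t a : ℕ) (v : ℤ) :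
    F t ^ (if t = a then v else 0).natAbs = if t = a then F a ^ v.natAbs else 1 := by
  split_ifs with h
  · rw [h]
  · simp

/-- The product `∏ F(t)^{|thetaBody m t|}` over the divisors, for `F` valued in `±1`, collapses to `F m ^ 2 · …` bookkeeping (the Kummer generator of a theta vector). -/
theorem prod_pow_natAbs_thetaBody {N m : ℕ} (F : ℕ → ℤ) (hF : ∀ t ∈ N.divisors, F t = 1 ∨ F t = -1)
    (h1 : 1 ∈ N.divisors) (h2 : 2 ∈ N.divisors) (h4 : 4 ∈ N.divisors) (hm : m ∈ N.divisors)
    (h2m : 2 * m ∈ N.divisors) (h4m : 4 * m ∈ N.divisors) :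
    ∏ t ∈ N.divisors, F t ^ (thetaBody m t).natAbs =
      F 1 ^ 2 * F 2 ^ 5 * F 4 ^ 2 * F m ^ 2 * F (2 * m) ^ 5 * F (4 * m) ^ 2 := by
  have key : ∀ t ∈ N.divisors, F t ^ (thetaBody m t).natAbs =
      (if t = 1 then F 1 ^ (2 : ℤ).natAbs else 1) * (if t = 2 then F 2 ^ (-5 : ℤ).natAbs else 1) *
      (if t = 4 then F 4 ^ (2 : ℤ).natAbs else 1) * (if t = m then F m ^ (-2 : ℤ).natAbs else 1) *
      (if t = 2 * m then F (2 * m) ^ (5 : ℤ).natAbs else 1) *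
      (if t = 4 * m then F (4 * m) ^ (-2 : ℤ).natAbs else 1) := by
    intro t ht
    rw [thetaBody, unit_pow_natAbs_add (hF t ht), unit_pow_natAbs_add (hF t ht), unit_pow_natAbs_add (hF t ht),
      unit_pow_natAbs_add (hF t ht), unit_pow_natAbs_add (hF t ht), pow_natAbs_ite, pow_natAbs_ite, pow_natAbs_ite,
      pow_natAbs_ite, pow_natAbs_ite, pow_natAbs_ite]
  rw [Finset.prod_congr rfl key]
  simp only [Finset.prod_mul_distrib, Finset.prod_ite_eq', h1, h2, h4, hm, h2m, h4m, if_true]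
  norm_num

/-- The Kummer generator of `Θ_m` is the Kronecker symbol `(m | ·)`: `(∏ t^{|θ_m(t)|} | d) = (m | d)`. -/
theorem jacobiSym_thetaGenerator {N m d : ℕ} (h1 : 1 ∈ N.divisors) (h2 : 2 ∈ N.divisors) (h4 : 4 ∈ N.divisors)
    (hm : m ∈ N.divisors) (h2m : 2 * m ∈ N.divisors) (h4m : 4 * m ∈ N.divisors)
    (hcop : ∀ t ∈ N.divisors, Int.gcd (t : ℤ) d = 1) :
    J(((∏ t ∈ N.divisors, t ^ (thetaBody m t).natAbs : ℕ) : ℤ) | d) = J((m : ℤ) | d) := by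
  rw [jacobiSym_natCast_prod_pow,
    prod_pow_natAbs_thetaBody (fun t => J((t : ℤ) | d)) (fun t ht => jacobiSym.eq_one_or_neg_one (hcop t ht))
      h1 h2 h4 hm h2m h4m]
  have e4 : J(((4 : ℕ) : ℤ) | d) = J(2 | d) * J(2 | d) := by
    rw [show ((4 : ℕ) : ℤ) = 2 * 2 by norm_num, jacobiSym.mul_left]
  have e2m : J(((2 * m : ℕ) : ℤ) | d) = J(2 | d) * J((m : ℤ) | d) := by
    rw [Nat.cast_mul, show ((2 : ℕ) : ℤ) = 2 from rfl, jacobiSym.mul_left]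
  have e4m : J(((4 * m : ℕ) : ℤ) | d) = J(2 | d) * J(2 | d) * J((m : ℤ) | d) := by
    rw [Nat.cast_mul, show ((4 : ℕ) : ℤ) = 2 * 2 by norm_num, jacobiSym.mul_left, jacobiSym.mul_left]
  rw [Nat.cast_one, jacobiSym.one_left, e4, e2m, e4m, show J(((2 : ℕ) : ℤ) | d) = J(2 | d) from rfl]
  have g2 : Int.gcd (2 : ℤ) d = 1 := by exact_mod_cast hcop 2 h2
  have gm : Int.gcd (m : ℤ) d = 1 := hcop m hm
  rcases jacobiSym.eq_one_or_neg_one g2 with h | h <;> rcases jacobiSym.eq_one_or_neg_one gm with h' | h' <;>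
    rw [h, h'] <;> norm_num

/-! ### The theta realisations -/

/-- A divisor of `4m` (`m > 0`) is a member of `(4m).divisors`. -/
theorem mem_divisors_four_mul {m : ℕ} (hm : 0 < m) {a : ℕ} (ha : a ∣ 4 * m) : a ∈ (4 * m).divisors :=
  Nat.mem_divisors.mpr ⟨ha, by omega⟩

/-- The theta vector is supported on the divisors of `4m`. -/
theorem thetaBody_eq_zero {m t : ℕ} (hm : 0 < m) (ht : t ∉ (4 * m).divisors) : thetaBody m t = 0 := by
  have h1 : t ≠ 1 := by intro h; rw [h] at ht; exact ht (mem_divisors_four_mul hm (one_dvd _))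
  have h2 : t ≠ 2 := by intro h; rw [h] at ht; exact ht (mem_divisors_four_mul hm (Dvd.intro (2 * m) (by ring)))
  have h4 : t ≠ 4 := by intro h; rw [h] at ht; exact ht (mem_divisors_four_mul hm (Dvd.intro m rfl))
  have h5 : t ≠ m := by intro h; rw [h] at ht; exact ht (mem_divisors_four_mul hm (Dvd.intro_left 4 rfl))
  have h6 : t ≠ 2 * m := by intro h; rw [h] at ht; exact ht (mem_divisors_four_mul hm (Dvd.intro 2 (by ring)))
  have h7 : t ≠ 4 * m := by intro h; rw [h] at ht; exact ht (mem_divisors_four_mul hm dvd_rfl)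
  simp [thetaBody, h1, h2, h4, h5, h6, h7]

/-- `thetaBody m` vanishes off the divisors of any multiple `M` of `4m`. -/
theorem thetaBody_eq_zero_of_dvd {m M t : ℕ} (hm : 0 < m) (hM : 4 * m ∣ M) (hM0 : M ≠ 0) (ht : t ∉ M.divisors) :
    thetaBody m t = 0 :=
  thetaBody_eq_zero hm fun h => ht (Nat.divisors_subset_of_dvd hM0 hM h)

/-- Newman's conditions for `Θ_m` on `X₀(4m)` (`m` odd). -/
theorem newmanCond_theta_four {m : ℕ} (hm : Odd m) (r : ℕ → ℤ) (hr : ∀ t, r t = 2 * thetaBody m t) :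
    NewmanCond (4 * m) r 0 := by
  have hm0 : 0 < m := hm.pos
  have h1 : 1 ∈ (4 * m).divisors := mem_divisors_four_mul hm0 (one_dvd _)
  have h2 : 2 ∈ (4 * m).divisors := mem_divisors_four_mul hm0 (Dvd.intro (2 * m) (by ring))
  have h4 : 4 ∈ (4 * m).divisors := mem_divisors_four_mul hm0 (Dvd.intro m rfl)
  have hmm : m ∈ (4 * m).divisors := mem_divisors_four_mul hm0 (Dvd.intro_left 4 rfl)
  have h2m : 2 * m ∈ (4 * m).divisors := mem_divisors_four_mul hm0 (Dvd.intro 2 (by ring))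
  have h4m : 4 * m ∈ (4 * m).divisors := mem_divisors_four_mul hm0 dvd_rfl
  have D2 : 4 * m / 2 = 2 * m := by omega
  have D4 : 4 * m / 4 = m := by omega
  have Dm : 4 * m / m = 4 := Nat.mul_div_cancel 4 hm0
  have D2m : 4 * m / (2 * m) = 2 := by rw [show 4 * m = 2 * (2 * m) by ring]; exact Nat.mul_div_cancel 2 (by omega)
  have D4m : 4 * m / (4 * m) = 1 := Nat.div_self (by omega)
  refine ⟨?_, ?_, ?_, ?_⟩
  · have H : ∑ δ ∈ (4 * m).divisors, r δ * 1 = 2 * (2 * 1 - 5 * 1 + 2 * 1 - 2 * 1 + 5 * 1 - 2 * 1) :=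
      sum_theta_weight h1 h2 h4 hmm h2m h4m r hr (fun _ => 1)
    simpa using H
  · have H : ∑ δ ∈ (4 * m).divisors, r δ * (δ : ℤ) =
        2 * (2 * ((1 : ℕ) : ℤ) - 5 * ((2 : ℕ) : ℤ) + 2 * ((4 : ℕ) : ℤ) - 2 * ((m : ℕ) : ℤ) +
          5 * ((2 * m : ℕ) : ℤ) - 2 * ((4 * m : ℕ) : ℤ)) :=
      sum_theta_weight h1 h2 h4 hmm h2m h4m r hr (fun δ => (δ : ℤ))
    rw [Finset.sum_congr rfl fun (δ : ℕ) _ => mul_comm ((δ : ℕ) : ℤ) (r δ), H]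
    exact ⟨0, by push_cast; ring⟩
  · have H : ∑ δ ∈ (4 * m).divisors, r δ * ((4 * m / δ : ℕ) : ℤ) =
        2 * (2 * ((4 * m / 1 : ℕ) : ℤ) - 5 * ((4 * m / 2 : ℕ) : ℤ) + 2 * ((4 * m / 4 : ℕ) : ℤ) -
          2 * ((4 * m / m : ℕ) : ℤ) + 5 * ((4 * m / (2 * m) : ℕ) : ℤ) - 2 * ((4 * m / (4 * m) : ℕ) : ℤ)) :=
      sum_theta_weight h1 h2 h4 hmm h2m h4m r hr (fun δ => ((4 * m / δ : ℕ) : ℤ))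
    rw [Finset.sum_congr rfl fun (δ : ℕ) _ => mul_comm (((4 * m / δ : ℕ) : ℤ)) (r δ), H, Nat.div_one, D2, D4, Dm, D2m,
      D4m]
    exact ⟨0, by push_cast; ring⟩
  · refine ⟨∏ δ ∈ (4 * m).divisors, δ ^ (thetaBody m δ).natAbs, ?_⟩
    rw [← Finset.prod_mul_distrib]
    refine Finset.prod_congr rfl fun δ _ => ?_
    rw [hr, Int.natAbs_mul, show (2 : ℤ).natAbs = 2 from rfl, two_mul, pow_add]

/-- A divisor `t` of `N` is coprime to any `d` coprime to `N` (as an integer gcd). -/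
theorem coprime_of_mem_divisors {N t d : ℕ} (ht : t ∈ N.divisors) (hd : Nat.Coprime d N) : Int.gcd (t : ℤ) d = 1 := by
  rw [Int.gcd_natCast_natCast]
  exact Nat.Coprime.coprime_dvd_left (Nat.dvd_of_mem_divisors ht) hd.symm

/-- `Θ_m` on `X₀(8m)` realises `(m | ·)` (`m` odd). -/
theorem realisesJ_theta_eight {m : ℕ} (hm : Odd m) : RealisesJ (8 * m) (thetaBody m) m := by
  have hm0 : 0 < m := hm.pos
  have h84 : 4 * m ∣ 8 * m := Dvd.intro 2 (by ring)
  have h80 : 8 * m ≠ 0 := by omega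
  have mem : ∀ a, a ∣ 4 * m → a ∈ (8 * m).divisors := fun a ha =>
    Nat.divisors_subset_of_dvd h80 h84 (mem_divisors_four_mul hm0 ha)
  refine ⟨newmanCond_theta_eight hm _ (fun _ => rfl), hasEvenCuspOrders_theta_eight hm _ (fun _ => rfl),
    fun d hd hdN => ?_⟩
  exact jacobiSym_thetaGenerator (mem 1 (one_dvd _)) (mem 2 (Dvd.intro (2 * m) (by ring))) (mem 4 (Dvd.intro m rfl))
    (mem m (Dvd.intro_left 4 rfl)) (mem (2 * m) (Dvd.intro 2 (by ring))) (mem (4 * m) dvd_rfl)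
    (fun t ht => coprime_of_mem_divisors ht hdN)

/-- `Θ_m` on `X₀(4m)` realises `(m | ·)` (`m ≡ 1 (mod 4)`). -/
theorem realisesJ_theta_four {m : ℕ} (hm : Odd m) (hm1 : m % 4 = 1) : RealisesJ (4 * m) (thetaBody m) m := by
  have hm0 : 0 < m := hm.pos
  have mem : ∀ a, a ∣ 4 * m → a ∈ (4 * m).divisors := fun a ha => mem_divisors_four_mul hm0 ha
  refine ⟨newmanCond_theta_four hm _ (fun _ => rfl), (hasEvenCuspOrders_theta_four_iff hm _ (fun _ => rfl)).mp hm1,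
    fun d hd hdN => ?_⟩
  exact jacobiSym_thetaGenerator (mem 1 (one_dvd _)) (mem 2 (Dvd.intro (2 * m) (by ring))) (mem 4 (Dvd.intro m rfl))
    (mem m (Dvd.intro_left 4 rfl)) (mem (2 * m) (Dvd.intro 2 (by ring))) (mem (4 * m) dvd_rfl)
    (fun t ht => coprime_of_mem_divisors ht hdN)

/-- `Θ₂` on `X₀(32)` realises `(2 | ·) = χ₈'`-type Kronecker symbol `(2 | d)` (kernel-decided level-`32` instance). -/
theorem realisesJ_theta_two : RealisesJ 32 (thetaBody 2) 2 := by
  refine ⟨⟨by decide, by decide, by decide, isSquare_prod_pow_natAbs_two_mul _ _⟩, ?_, fun d hd hdN => ?_⟩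
  · unfold HasEvenCuspOrders cuspOrder24 thetaBody; decide
  · have hs : (∏ t ∈ (32 : ℕ).divisors, t ^ (thetaBody 2 t).natAbs : ℕ) = 2 ^ 27 := by decide
    have g2 : Int.gcd (2 : ℤ) d = 1 := by
      rw [show (2 : ℤ) = ((2 : ℕ) : ℤ) from rfl, Int.gcd_natCast_natCast]
      exact Nat.Coprime.coprime_dvd_left (by norm_num : 2 ∣ 32) hdN.symm
    rw [hs, Nat.cast_pow, Nat.cast_ofNat, jacobiSym.pow_left]
    rcases jacobiSym.eq_one_or_neg_one g2 with h | h <;> rw [h] <;> norm_num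

/-- **The construction**: every admissible `q` is realised at level `N`. -/
theorem exists_realisesJ {N q : ℕ} (h4N : 4 ∣ N) (hN : N ≠ 0) (hsq : Squarefree q) (hqN : q ∣ N)
    (hodd : ¬ 32 ∣ N → Odd q) (hmod : ¬ 8 ∣ N → q % 4 = 1) : ∃ r : ℕ → ℤ, RealisesJ N r q := by
  have hq0 : q ≠ 0 := hsq.ne_zero
  by_cases h8 : 8 ∣ N
  · -- `q = 2^b · q'`, `q'` odd, `b ≤ 1`
    have hq'odd : Odd (ordCompl[2] q) := Nat.coprime_two_left.mp (Nat.coprime_ordCompl Nat.prime_two hq0)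
    have hq'N : ordCompl[2] q ∣ N := (Nat.ordCompl_dvd q 2).trans hqN
    have hdec : 2 ^ q.factorization 2 * ordCompl[2] q = q := Nat.ordProj_mul_ordCompl_eq_self q 2
    set q' := ordCompl[2] q with hq'def
    have hq'0 : 0 < q' := hq'odd.pos
    have hcop8 : Nat.Coprime 8 q' := by
      have := (Nat.coprime_two_left.mpr hq'odd).pow_left 3
      norm_num at this; exact this
    have h8q' : 8 * q' ∣ N := Nat.Coprime.mul_dvd_of_dvd_of_dvd hcop8 h8 hq'N
    have hR₁ : RealisesJ N (thetaBody q') q' :=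
      realisesJ_of_dvd h8q' hN
        (fun t ht => thetaBody_eq_zero_of_dvd hq'0 (Dvd.intro 2 (by ring)) (by omega) ht)
        (realisesJ_theta_eight hq'odd)
    have hb : q.factorization 2 ≤ 1 := (Nat.squarefree_iff_factorization_le_one hq0).mp hsq 2
    rcases Nat.eq_zero_or_pos (q.factorization 2) with hb0 | hbpos
    · rw [hb0, pow_zero, one_mul] at hdec
      rw [hdec] at hR₁
      exact ⟨_, hR₁⟩
    · have hb1 : q.factorization 2 = 1 := le_antisymm hb hbpos
      rw [hb1, pow_one] at hdec
      have h32 : 32 ∣ N := by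
        by_contra h
        have hq := hodd h
        rw [← hdec] at hq
        exact (Nat.not_even_iff_odd.mpr hq) (even_two_mul _)
      have hR₂ : RealisesJ N (thetaBody 2) 2 :=
        realisesJ_of_dvd h32 hN (fun t ht => thetaBody_eq_zero_of_dvd (by norm_num) (by norm_num) (by norm_num) ht)
          realisesJ_theta_two
      have := realisesJ_mul hR₂ hR₁
      rw [hdec] at this
      exact ⟨_, this⟩
  · have h32 : ¬ 32 ∣ N := fun h => h8 ((Dvd.intro 4 rfl : 8 ∣ 32).trans h)
    have hqodd : Odd q := hodd h32
    have hq1 : q % 4 = 1 := hmod h8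
    have hcop4 : Nat.Coprime 4 q := by
      have := (Nat.coprime_two_left.mpr hqodd).pow_left 2
      norm_num at this; exact this
    have h4q : 4 * q ∣ N := Nat.Coprime.mul_dvd_of_dvd_of_dvd hcop4 h4N hqN
    exact ⟨thetaBody q, realisesJ_of_dvd h4q hN
      (fun t ht => thetaBody_eq_zero_of_dvd hqodd.pos dvd_rfl (by omega) ht) (realisesJ_theta_four hqodd hq1)⟩

/-- **E-an-154 from the classification of Shimura 2-characters.**  `ShimuraTwoCharIsKronecker → SigmaTwoIsEtaKummerAtFour`:
the modular-forms content (theta family, level raising, products, Kummer bridge) is fully proved; what remains is that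
every even quadratic character through the Shimura radical is a Kronecker symbol `(q | ·)` of the admissible shape. -/
theorem sigmaTwoIsEtaKummerAtFour_of_isKronecker (hK : ShimuraTwoCharIsKronecker) : SigmaTwoIsEtaKummerAtFour := by
  intro N h4N χ hχ
  rcases Nat.eq_zero_or_pos N with hN0 | hNpos
  · subst hN0
    refine ⟨fun _ => 0, ⟨by simp, by simp, by simp, ⟨1, by simp⟩⟩, fun c hc => by simp at hc, ?_⟩
    intro a b c d _ hc hNc
    exfalso
    simp at hNc
    omega
  have hN : N ≠ 0 := hNpos.ne'
  obtain ⟨q, hsq, hqN, hodd, hmod, hval⟩ := hK N h4N hN χ hχ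
  obtain ⟨r, hn, he, hj⟩ := exists_realisesJ h4N hN hsq hqN hodd hmod
  refine ⟨fun t => 2 * r t, hn, he, kummerClassEqShimura_of_jacobi h4N r χ hn he fun d hd hdN => ?_⟩
  have hcop : Nat.Coprime d.natAbs N := by
    have := Int.isCoprime_iff_gcd_eq_one.mp hdN
    rw [Int.gcd_eq_natAbs, Int.natAbs_natCast] at this
    exact this
  rw [hj d.natAbs (Int.natAbs_odd.mpr hd) hcop, hval d hd hdN]

end SigmaTwoEta

end Summit.BirchSwinnertonDyer.Rank1Residual.ManinAdditive.SigmaEta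

namespace Summit.BirchSwinnertonDyer.Rank1Residual.ManinAdditive.SigmaEta

open Literature.NumberTheory.ModularForms
open Literature.NumberTheory.EllipticCurves.ModularForms
open scoped NumberTheorySymbols

/-- E-an-158 by name (proof: `ShimuraKronecker.lean`). -/
theorem shimuraTwoCharIsKronecker_holds : ShimuraTwoCharIsKronecker := shimuraTwoCharIsKronecker

/-- **E-an-154 `SigmaTwoIsEtaKummerAtFour` (tree conjecture, `SigmaEtaKummer.lean`) is a theorem.** -/
theorem sigmaTwoIsEtaKummerAtFour_holds : SigmaTwoIsEtaKummerAtFour :=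
  sigmaTwoIsEtaKummerAtFour_of_isKronecker shimuraTwoCharIsKronecker

/-- **E-an-154♯ — the sharper export for the C2 LEAD (blind branch).**  For `4 ∣ N ≠ 0` and `χ ∈ Σ(N)[2]` the
η-representative can be taken with ALL EXPONENTS EVEN (`2r'`, with `r'` a product of level-raised theta bodies realising
the Kronecker symbol of E-an-158): there are an admissible squarefree `q ∣ N` and `r'` with `RealisesJ N r' q`,
`KummerClassEqShimura N (2r') χ` and `χ(d) = (q | |d|)` for odd `d` coprime to `N`. -/
theorem exists_even_etaRealisation_of_isShimuraTwoChar {N : ℕ} (h4N : 4 ∣ N) (hN : N ≠ 0)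
    (χ : DirichletCharacter ℤ N) (hχ : IsShimuraTwoChar N χ) :
    ∃ q : ℕ, ∃ r : ℕ → ℤ, Squarefree q ∧ q ∣ N ∧ (¬ 32 ∣ N → Odd q) ∧ (¬ 8 ∣ N → q % 4 = 1) ∧
      RealisesJ N r q ∧ KummerClassEqShimura N (fun t => 2 * r t) χ ∧
      ∀ d : ℤ, Odd d → IsCoprime d N → χ (d : ZMod N) = J(q | d.natAbs) := by
  obtain ⟨q, hsq, hqN, hodd, hmod, hval⟩ := shimuraTwoCharIsKronecker N h4N hN χ hχ
  obtain ⟨r, hR⟩ := exists_realisesJ h4N hN hsq hqN hodd hmod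
  refine ⟨q, r, hsq, hqN, hodd, hmod, hR, ?_, hval⟩
  obtain ⟨hn, he, hj⟩ := hR
  refine kummerClassEqShimura_of_jacobi h4N r χ hn he fun d hd hdN => ?_
  have hcop : Nat.Coprime d.natAbs N := by
    have := Int.isCoprime_iff_gcd_eq_one.mp hdN
    rw [Int.gcd_eq_natAbs, Int.natAbs_natCast] at this
    exact this
  rw [hj d.natAbs (Int.natAbs_odd.mpr hd) hcop, hval d hd hdN]

end Summit.BirchSwinnertonDyer.Rank1Residual.ManinAdditive.SigmaEta
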